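import Mathlib
import Summits.ResolutionOfSingularities.ResolutionOfSingularities.Theorems.WeightedInvariantLocalWeightedDropWildMonicFlagDropAxisSplit
import Summits.ResolutionOfSingularities.ResolutionOfSingularities.Theorems.WeightedInvariantLocalWeightedDropWildMonicFlagDropAxisN1Change
import Summits.ResolutionOfSingularities.ResolutionOfSingularities.Theorems.WeightedInvariantLocalWeightedDropWildPurePowerFlagStepT
import Summits.ResolutionOfSingularities.ResolutionOfSingularities.Theorems.WeightedInvariantLocalWeightedDropWildMonicFlagDropTangentFirst

/-!
# S3ρ flag line, DROP SIDE, (D5) `DropAxisN1Second` — part B: the `n_G = 1` child flag IN ITS SECOND PRESENTATION has the triple of a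
# first-orientation tangent flag, validity transports, and **(D5) follows from (D2) `DropAxisTangentFirst`**

Crux item stmt-ResolutionOfSingularities-8899 `LocalWeightedDrop` (route `ResolutionOfSingularities/WeightedInvariant`), engine of the
door `HypersurfaceCentreConstruction` stmt-ResolutionOfSingularities-19897.  [OURS · L1 W4.3, chain w43; hand res-D-repro-2 on target (D5)
`DropAxisN1Second` of res-type-083's `…WildMonicFlagDropAxisSplit` (UNCLAIMED-STUB LIST 2026-08-27T08:48:48Z, res-L1-w43-plan-1 DEALS #12,
res-plan-2 IDLE POOL DEAL #4d); reduction as in res-D-pv-056 AS stub-5's DESIGN HINT 08:58:42Z; part A = `…WildMonicFlagDropAxisN1Change`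
(the presentation change `θ_{h₂}^* τ_c^*` and the invariance of the `n = 1` numbers).  MODEL: S. Perlega, arXiv:2011.14443 Prop. 9.1.4 case (3),
second presentation; Hauser–Perlega, PRIMS 60 (2024) p. 784.  Every object is OURS; nothing here is a statement of H. Hironaka's manuscript
[claim: Hironaka2017, status: under-review].  This file is def-free.]

* §5 `exists_linShift_add_of_order_one` (`h = c·X + h₂`, `c = [X]h ≠ 0`, `ord h₂ ≥ 2`), `mem_of_isTangent_swapE_of_order_one` (both letters
  are boundary), stub-1's `PurePowerFlag.isTangent_C_mul_X` (the comparison flag `(g̃, c⁻¹·X)` is a first-orientation TANGENT flag), `mOf_second_eq_first`,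
  `flagTriple_second_eq_first`, `isMMax_first_of_second` (validity through the bijection `g ↦ g̃`);
* §6 **`dropAxisN1Second_of_dropAxisTangentFirst : DropAxisTangentFirst d p k → DropAxisN1Second d p k`**.
-/

set_option linter.dupNamespace false -- mandated namespace of this single-conjunct summit

noncomputable section

namespace Summit.ResolutionOfSingularities.ResolutionOfSingularities.Theorems

namespace WildMonic

open MvPowerSeries MonicDescent Literature.AlgebraicGeometry.Resolution
open Literature.AlgebraicGeometry.Resolution.HauserPerlega2024 (Triple)
open PurePowerFlag (swap swapE IsN0 IsTangent succE)

variable {k : Type} [Field k] {d : ℕ}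

/-! ## §5 Triples and validity of the two presentations -/

section Triples

/-- The linear shear `a·X`, `a ≠ 0`, has order `1`. -/
theorem order_linShift {a : k} (ha : a ≠ 0) : (PowerSeries.C a * PowerSeries.X).order = 1 := by
  have h : (PowerSeries.C a * PowerSeries.X : PowerSeries k) = PowerSeries.C a * PowerSeries.X ^ 1 := by rw [pow_one]
  rw [h]
  show (PowerSeries.C a * PowerSeries.X ^ 1 : PowerSeries k).order = ((1 : ℕ) : ℕ∞)
  rw [PowerSeries.order_eq_nat]
  refine ⟨?_, fun i hi => ?_⟩
  · rw [PowerSeries.coeff_C_mul_X_pow]; simpa using ha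
  · rw [PowerSeries.coeff_C_mul_X_pow, if_neg (by omega)]

/-- The linear shear `a·X`, `a ≠ 0`, is non-zero. -/
theorem linShift_ne_zero {a : k} (ha : a ≠ 0) : (PowerSeries.C a * PowerSeries.X : PowerSeries k) ≠ 0 := by
  intro h
  have := order_linShift ha
  rw [h, PowerSeries.order_zero] at this
  exact ENat.top_ne_coe 1 this

/-- The boundary letters of an order-one tangent flag: both letters are boundary. -/
theorem mem_of_isTangent_swapE_of_order_one {E' : Finset (Fin 2)} {h : PowerSeries k} (ht : IsTangent (swapE E') h) (h1 : h.order = 1) :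
    (0 : Fin 2) ∈ E' ∧ (1 : Fin 2) ∈ E' := by
  obtain ⟨h1E, -, hor⟩ := ht
  rw [PurePowerFlag.mem_swapE, Equiv.swap_apply_right] at h1E
  rcases hor with h2 | h0E
  · exfalso; rw [h1] at h2; exact absurd h2 (by decide)
  · rw [PurePowerFlag.mem_swapE, Equiv.swap_apply_left] at h0E
    exact ⟨h1E, h0E⟩

/-- Decomposition of an order-one series: `h = c·X + h₂`, `c = [X] h ≠ 0`, `ord h₂ ≥ 2`. -/
theorem exists_linShift_add_of_order_one {h : PowerSeries k} (hh : PowerSeries.constantCoeff h = 0) (h1 : h.order = 1) :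
    ∃ (c : k) (h₂ : PowerSeries k), c ≠ 0 ∧ PowerSeries.constantCoeff h₂ = 0 ∧ (2 : ℕ∞) ≤ h₂.order ∧
      h = PowerSeries.C c * PowerSeries.X + h₂ := by
  refine ⟨PowerSeries.coeff 1 h, h - PowerSeries.C (PowerSeries.coeff 1 h) * PowerSeries.X, ?_, ?_, ?_, ?_⟩
  · have hne : h ≠ 0 := by intro h0; rw [h0, PowerSeries.order_zero] at h1; exact ENat.top_ne_coe 1 h1
    have := PowerSeries.coeff_order hne
    rwa [h1] at this
  · rw [map_sub, hh, PurePowerFlag.constantCoeff_linShift, sub_zero]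
  · refine PowerSeries.nat_le_order _ 2 fun i hi => ?_
    have hX : (PowerSeries.C (PowerSeries.coeff 1 h) * PowerSeries.X : PowerSeries k) =
        PowerSeries.C (PowerSeries.coeff 1 h) * PowerSeries.X ^ 1 := by rw [pow_one]
    rw [map_sub, hX, PowerSeries.coeff_C_mul_X_pow]
    interval_cases i
    · rw [if_neg (by omega), sub_zero, PowerSeries.coeff_zero_eq_constantCoeff, hh]
    · rw [if_pos rfl, sub_self]
  · rw [add_sub_cancel]

variable {B : Fin d → MvPowerSeries (Fin 2) k} {E' : Finset (Fin 2)}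

/-- **`mOf` AGREES between the presentations** (second orientation `(g, c·X + h₂)` on `swapT B`, first orientation `(g̃, c⁻¹·X)` on `B`). -/
theorem mOf_second_eq_first {c : k} (hc : c ≠ 0) {h₂ : PowerSeries k} (hh₂ : PowerSeries.constantCoeff h₂ = 0) (h2 : (2 : ℕ∞) ≤ h₂.order)
    (h0 : (0 : Fin 2) ∈ E') (h1 : (1 : Fin 2) ∈ E') (horder : (PowerSeries.C c * PowerSeries.X + h₂).order = 1)
    (g : MvPowerSeries (Fin 2) k) :
    mOf d (swapT B) (swapE E') g (PowerSeries.C c * PowerSeries.X + h₂) = mOf d B E' (subst (![MvPowerSeries.C c⁻¹ * X 0 + X 1, MvPowerSeries.C (-c) * X 1] : Fin 2 → MvPowerSeries (Fin 2) k) (subst (PurePowerFlag.shift (-h₂)) g)) (PowerSeries.C c⁻¹ * PowerSeries.X) := by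
  have hne : (PowerSeries.C c * PowerSeries.X + h₂ : PowerSeries k) ≠ 0 := by
    intro h0'; rw [h0', PowerSeries.order_zero] at horder; exact ENat.top_ne_coe 1 horder
  have hn2 : ¬ IsN0 (swapE E') (PowerSeries.C c * PowerSeries.X + h₂) := by
    rintro (hmem | hzero)
    · exact hmem (by rw [PurePowerFlag.mem_swapE, Equiv.swap_apply_right]; exact h0)
    · exact hne hzero
  have hn1 : ¬ IsN0 E' (PowerSeries.C c⁻¹ * PowerSeries.X) := by
    rintro (hmem | hzero)
    · exact hmem h1
    · exact linShift_ne_zero (inv_ne_zero hc) hzero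
  rw [mOf_of_not_isN0 hn2, mOf_of_not_isN0 hn1, PurePowerFlag.tangency, PurePowerFlag.tangency, horder, order_linShift (inv_ne_zero hc),
    ENat.toNat_one]
  exact (mFlagN_dFlagN_eq_of_presentation hc hh₂ h2 _ B g).1

/-- **THE TRIPLES AGREE** between the presentations. -/
theorem flagTriple_second_eq_first {c : k} (hc : c ≠ 0) {h₂ : PowerSeries k} (hh₂ : PowerSeries.constantCoeff h₂ = 0)
    (h2 : (2 : ℕ∞) ≤ h₂.order) (h0 : (0 : Fin 2) ∈ E') (h1 : (1 : Fin 2) ∈ E') (horder : (PowerSeries.C c * PowerSeries.X + h₂).order = 1)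
    (g : MvPowerSeries (Fin 2) k) :
    flagTriple d (swapT B) (swapE E') g (PowerSeries.C c * PowerSeries.X + h₂) =
      flagTriple d B E' (subst (![MvPowerSeries.C c⁻¹ * X 0 + X 1, MvPowerSeries.C (-c) * X 1] : Fin 2 → MvPowerSeries (Fin 2) k) (subst (PurePowerFlag.shift (-h₂)) g)) (PowerSeries.C c⁻¹ * PowerSeries.X) := by
  have hne : (PowerSeries.C c * PowerSeries.X + h₂ : PowerSeries k) ≠ 0 := by
    intro h0'; rw [h0', PowerSeries.order_zero] at horder; exact ENat.top_ne_coe 1 horder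
  have hn2 : ¬ IsN0 (swapE E') (PowerSeries.C c * PowerSeries.X + h₂) := by
    rintro (hmem | hzero)
    · exact hmem (by rw [PurePowerFlag.mem_swapE, Equiv.swap_apply_right]; exact h0)
    · exact hne hzero
  have hn1 : ¬ IsN0 E' (PowerSeries.C c⁻¹ * PowerSeries.X) := by
    rintro (hmem | hzero)
    · exact hmem h1
    · exact linShift_ne_zero (inv_ne_zero hc) hzero
  rw [flagTriple_of_not_isN0 hn2, flagTriple_of_not_isN0 hn1, PurePowerFlag.tangency, PurePowerFlag.tangency, horder,
    order_linShift (inv_ne_zero hc), ENat.toNat_one, (mFlagN_dFlagN_eq_of_presentation hc hh₂ h2 _ B g).2]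

/-- **VALIDITY TRANSPORTS** through the bijection `g ↦ g̃` of legal re-centrings. -/
theorem isMMax_first_of_second {c : k} (hc : c ≠ 0) {h₂ : PowerSeries k} (hh₂ : PowerSeries.constantCoeff h₂ = 0)
    (h2 : (2 : ℕ∞) ≤ h₂.order) (h0 : (0 : Fin 2) ∈ E') (h1 : (1 : Fin 2) ∈ E') (horder : (PowerSeries.C c * PowerSeries.X + h₂).order = 1)
    {g : MvPowerSeries (Fin 2) k} (hmax : IsMMax d (swapT B) (swapE E') g (PowerSeries.C c * PowerSeries.X + h₂)) :
    IsMMax d B E' (subst (![MvPowerSeries.C c⁻¹ * X 0 + X 1, MvPowerSeries.C (-c) * X 1] : Fin 2 → MvPowerSeries (Fin 2) k) (subst (PurePowerFlag.shift (-h₂)) g)) (PowerSeries.C c⁻¹ * PowerSeries.X) := by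
  intro g' hg'
  have h := hmax (subst (PurePowerFlag.shift h₂) (subst (![X 1 + MvPowerSeries.C c * X 0, MvPowerSeries.C (-c⁻¹) * X 1] : Fin 2 → MvPowerSeries (Fin 2) k) g')) (constantCoeff_subst_shift_tau c hh₂ hg')
  rwa [mOf_second_eq_first hc hh₂ h2 h0 h1 horder, mOf_second_eq_first hc hh₂ h2 h0 h1 horder, subst_tauInv_shiftNeg_subst_shift_tau hc hh₂] at h

end Triples

/-! ## §6 (D5) from (D2) -/

/-- **(D5) `DropAxisN1Second` FROM (D2) `DropAxisTangentFirst`** [Per17 Prop. 9.1.4 case (3), second presentation]: the `n_G = 1` child flag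
`(true, g, h)`, `ord h = 1`, has the same triple as the first-orientation tangent flag `(g̃, c⁻¹·X)` (`c = [X]h`), which is valid when
`(g, h)` is; (D2) dominates the latter by a first-orientation flag of the raw parent. -/
theorem dropAxisN1Second_of_dropAxisTangentFirst {p : ℕ} (hD2 : DropAxisTangentFirst d p k) : DropAxisN1Second d p k := by
  intro A E T φ' hstep g h hg hh ht h1 hmm
  obtain ⟨c, h₂, hc, hh₂, h2, rfl⟩ := exists_linShift_add_of_order_one hh h1
  obtain ⟨h0E, h1E⟩ := mem_of_isTangent_swapE_of_order_one ht h1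
  rw [flagTriple_second_eq_first hc hh₂ h2 h0E h1E h1 g]
  exact hD2 A E T φ' hstep (subst (![MvPowerSeries.C c⁻¹ * X 0 + X 1, MvPowerSeries.C (-c) * X 1] : Fin 2 → MvPowerSeries (Fin 2) k) (subst (PurePowerFlag.shift (-h₂)) g)) (PowerSeries.C c⁻¹ * PowerSeries.X) (constantCoeff_subst_tauInv_shiftNeg c hh₂ hg)
    (PurePowerFlag.constantCoeff_linShift c⁻¹) (PurePowerFlag.isTangent_C_mul_X h0E h1E (inv_ne_zero hc))
    (isMMax_first_of_second hc hh₂ h2 h0E h1E h1 hmm)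

/-- **(D5) `DropAxisN1Second` HOLDS** (binder-free): (D2) is res-D-pv-056 AS stub-5's tree theorem `WildMonic.dropAxisTangentFirst`
(`…WildMonicFlagDropTangentFirst`, p517820), and (D5) follows from it by `dropAxisN1Second_of_dropAxisTangentFirst`.  Hypotheses exactly
those of (D2): `k` of characteristic `p` with `p`-th roots (`PerfectRing k p`), `0 < d`. -/
theorem dropAxisN1Second_holds (p : ℕ) [Fact p.Prime] [CharP k p] [PerfectRing k p] (hd : 0 < d) : DropAxisN1Second d p k :=
  dropAxisN1Second_of_dropAxisTangentFirst (dropAxisTangentFirst p hd)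

end WildMonic

end Summit.ResolutionOfSingularities.ResolutionOfSingularities.Theorems

end
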